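import Summits.QuantumFields.BalabanUV.T4Continuum.Support.NE7CornerSpikeTopDictionary
import Summits.QuantumFields.BalabanUV.T4Continuum.Support.NE3PureGaugeFirstVariation
import Summits.QuantumFields.BalabanUV.T4Continuum.Support.NE3CurvedFrameKill
import HarnessLib

/-!
# NE7QbarTangentCritical — A TANGENT-CRITICAL BACKGROUND IS CRITICAL ALONG THE WHOLE DOUBLE-BAR KERNEL (Bałaban's constraint space
# `Q̄_k Y = 0`), AND ALONG EVERY DIRECTION WHOSE DOUBLE-BAR AVERAGE IS A COARSE PURE GAUGE

Cell `pub-balaban`, rung (B)+1 sub-cell t4, lineage `b2b-balaban-t4-ne7-p1` (CRUX PROVER NE7 #1 = OWNER of row NE7), generation 99; memo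
`t4/b2b-balaban-t4-ne7-p1-g99/ROAD-G99.md` §2 (the Bałaban-gauge slice `𝒯_B(W)`).

WHY.  Row NE7's per-pair ENDs (`NE7HintOfSliceNormalisationSU2Dec.hint_SU2_of_decomposition` and its gen-98 re-issues) carry the criticality of the
tangent-critical background `U_s` only for TANGENT directions (`TangentIter L k U_s φ → dAction U_s φ F = 0`), and therefore ask the supplier for a
representative whose slice part lies in the FRAME-FREE block-Landau slice `T_♮(U_s) ⊂ {tangent}`.  Gen 99's audit (memo §1, numerics `corner_dip.py`
jobs j336996/j337005/j337006) shows that forcing a generic same-average representative into `T_♮ + O(X²)` inside a corner-trivial gauge costs CORNER DIPS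
of height `≍ framePotW X ≍ M·sup‖X‖` in the representative — incompatible with the END's sup currency `M·sup‖X‖ ≤ α̂`.  Bałaban's own slice has NO
frame condition and NO corner pinning: it is the double-bar kernel `{Q̄_{k+1} Y = 0}` cut by his Landau gauge (1.26).  THIS FILE supplies the
criticality half of that slice: a background that is critical along tangent directions is critical along EVERY skew periodic `Y` with
`QbarIter L (k+1) U_s Y = 0`, and more generally along every `Y` whose double-bar average is a coarse pure gauge `gaugeDir (cavgIter …) h`.
THE ARGUMENT (exact kinematics, any unitary background in the multi-level small-field class): by the structure theorem
`dirIter = QbarIter + gaugeDir(cavgIter)(framePotW)` (`NE3TangentCovariantTower.dirIter_eq_QbarIter_add_gaugeDir`) such a `Y` has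
`dirIter Y = gaugeDir (cavgIter) (h + framePotW Y)`; the top-corner SPIKE direction `S := gaugeDir U_s (spikeW M (h + framePotW Y))` has the SAME k-fold
linearised average (`NE7CornerSpikeTopDictionary.dirIter_gaugeDir_spikeW`); so `Y − S` is TANGENT (`tangentIter_iff_dirIter_eq_zero`, additivity
`dirIter_add`), `dAction U_s (Y − S) F = 0` by tangent-criticality, and `dAction U_s S F = 0` EXACTLY by gauge invariance of the Wilson action
(`NE3PureGaugeFirstVariation.dAction_add_gaugeDir`, any units-valued background, any generator).
WHAT ([folklore]; 0 def, 0 sorry; general `d`, `L ≥ 1`, every level `j+1`, every torus `N ≥ 1`, every window `F`).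
§1 `gaugeDir_zero_fun'`, `sub_add_dir`, `sub_add_dir'` (bookkeeping); §2 `tangentIter_sub_of_dirIter_eq` (equal k-fold averages ⟹ tangent difference),
**`tangentIter_sub_spike`** — `QbarIter L (j+1) W Y = gaugeDir (cavgIter L (j+1) W) h` ⟹ `Y − gaugeDir W (spikeW L^{j+1} (h + framePotW L (j+1) W Y))` is tangent;
§3 **`dAction_eq_zero_of_QbarIter_eq_gaugeDir`** — tangent-critical ⟹ critical along every such `Y`; **`dAction_eq_zero_of_QbarIter_eq_zero`** — in
   particular along the whole double-bar kernel.
HONEST FRAMING (page 1): exact linear kinematics of OUR linearised averaging plus exact gauge invariance of the Wilson action; nothing of Bałaban's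
asserted; the slice `𝒯_B(W)`, its Poincaré inequality and the curved sup letter are NOT here; NE7 NOT PROVED; spine 0∕9; finite T⁴ rung (B)+1 — NOT
infinite volume, NOT mass gap, NOT `BetaPertH`, NOT Clay.  Continuum YM on T⁴ ⇐ BetaPertH ∧ nine spine estimates (0/9 proved); BetaPertH ⇐ (D1) ∧ (D4) ∧
CAP+tail; G-an2-4 gates asym, D1 and NE2/3/4.  Text locations only: [Balaban1985Averaging] (42), (110)–(120) pp. 23–35; [Balaban1984PropagatorsI] (1.26) p. 20.
-/

set_option autoImplicit false

namespace Summit.QuantumFields.BalabanUV.T4Continuum.NE7QbarTangentCritical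

open Literature.MathematicalPhysics.QuantumFieldTheory.Balaban1983to89
open B7Prop1Explicit B7Prop2Explicit
open T4AveragingDeficitWall (IsUnitaryCfg IsSkewDir SmallField Plaq)
open T4AveragingDeficitWallBoundary (IsPeriodicCfg)
open AveragingDeficitPeriodicCounting (IsPeriodicDir)
open AveragingDeficitMultiLevelPrep (cavgIter LevelSmall tower TangentIter)
open BlockAveragePushDirGauge (gaugeDir isPeriodicDir_gaugeDir)
open NE3TangentCovariantTower (dirIter QbarIter framePotW dirIter_add dirIter_eq_QbarIter_add_gaugeDir tangentIter_iff_dirIter_eq_zero)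
open NE3TangentCovariantStructure (gaugeDir_add_fun)
open NE3CornerSpikes (spikeW spikeW_mem_skewAdjoint spikeW_add_period)
open NE7CornerSpikeTopDictionary (dirIter_gaugeDir_spikeW natCast_tower_eq_pow_mul)
open NE3LandauOrbit (gaugeDir_skew)
open NE3CurvedFrameKill (framePotW_skew_periodic)
open NE3HessForm (dAction)
open NE3PureGaugeFirstVariation (dAction_add_gaugeDir)

noncomputable section

variable {d : ℕ} {n : Type*} [Fintype n] [DecidableEq n]

/-! ## §1 Bookkeeping -/

/-- The gauge direction of the zero generator vanishes. [folklore] -/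
theorem gaugeDir_zero_fun' (W : Site d → Fin d → (Matrix n n ℂ)ˣ) :
    gaugeDir W (fun _ => (0 : Matrix n n ℂ)) = fun _ _ => 0 := by
  funext x μ
  simp [gaugeDir, T4AveragingDeficitWall.Ad]

omit [Fintype n] [DecidableEq n] in
/-- `Y − S` plus `S` is `Y`, as direction fields. [folklore] -/
theorem sub_add_dir (Y S : Site d → Fin d → Matrix n n ℂ) :
    (fun y μ => (Y y μ - S y μ) + S y μ) = Y := by
  funext y μ; exact sub_add_cancel _ _

omit [Fintype n] [DecidableEq n] in
/-- `Y − S` plus `S` is `Y`, pointwise-sum form. [folklore] -/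
theorem sub_add_dir' (Y S : Site d → Fin d → Matrix n n ℂ) :
    (fun y μ => Y y μ - S y μ) + S = Y := by
  funext y μ; simp

/-! ## §2 The spike-corrected direction is tangent -/

/-- **TWO DIRECTIONS WITH THE SAME k-FOLD LINEARISED AVERAGE DIFFER BY A TANGENT DIRECTION** (multi-level small-field class; additivity of `dirIter`).
[folklore] -/
theorem tangentIter_sub_of_dirIter_eq [Nonempty n] {L : ℕ} (hL : 1 ≤ L) (j : ℕ) {W : Site d → Fin d → (Matrix n n ℂ)ˣ} {x : ℝ}
    (hWu : IsUnitaryCfg W) (hx : 0 ≤ x) (hs : LevelSmall d L j x) (hWx : SmallField W x)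
    {Y S : Site d → Fin d → Matrix n n ℂ} (hYS : dirIter L (j + 1) W Y = dirIter L (j + 1) W S) :
    TangentIter L j W (fun y μ => Y y μ - S y μ) := by
  have hadd := dirIter_add hL j hWu hx hs hWx (fun y μ => Y y μ - S y μ) S
  rw [sub_add_dir Y S] at hadd
  rw [tangentIter_iff_dirIter_eq_zero]
  funext z κ
  have hz := congrArg (fun F => F z κ) hadd
  simp only at hz
  -- `hz : dirIter Y z κ = dirIter (Y − S) z κ + dirIter S z κ`, and `dirIter Y = dirIter S`
  have h2 : dirIter L (j + 1) W (fun y μ => Y y μ - S y μ) z κ + dirIter L (j + 1) W S z κ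
      = 0 + dirIter L (j + 1) W S z κ := by
    rw [zero_add, ← hz, hYS]
  rw [Pi.zero_apply, Pi.zero_apply]
  exact add_right_cancel h2

/-- **A DIRECTION WHOSE DOUBLE-BAR AVERAGE IS A COARSE PURE GAUGE IS TANGENT UP TO A TOP-CORNER SPIKE DIRECTION.**  Multi-level small-field class at a
unitary `W` of period `tower L N (j+1) = L^{j+1}·N` (`0 ≤ x`, `LevelSmall d L j x`, `SmallField W x`); `Y` skew `(L^{j+1}N)`-periodic; `h` skew `N`-periodic
with `QbarIter L (j+1) W Y = gaugeDir (cavgIter L (j+1) W) h`.  Then, with `g := h + framePotW L (j+1) W Y` and `M = L^{j+1}`, the direction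
`Y − gaugeDir W (spikeW M g)` is TANGENT (`TangentIter L j W`). [folklore] -/
theorem tangentIter_sub_spike [Nonempty n] {L N : ℕ} [NeZero N] (hL : 1 ≤ L) (j : ℕ) {W : Site d → Fin d → (Matrix n n ℂ)ˣ} {x : ℝ}
    (hWu : IsUnitaryCfg W) (hWP : IsPeriodicCfg W ((tower L N (j + 1) : ℕ) : ℤ)) (hx : 0 ≤ x) (hs : LevelSmall d L j x) (hWx : SmallField W x)
    {Y : Site d → Fin d → Matrix n n ℂ} (hY : IsSkewDir Y) (hYP : IsPeriodicDir Y ((tower L N (j + 1) : ℕ) : ℤ))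
    {h : Site d → Matrix n n ℂ} (hh : ∀ z, h z ∈ skewAdjoint (Matrix n n ℂ)) (hhP : ∀ (z : Site d) (τ : Fin d), h (z + (N : ℤ) • e τ) = h z)
    (hQ : QbarIter L (j + 1) W Y = gaugeDir (cavgIter L (j + 1) W) h) :
    TangentIter L j W (fun y μ => Y y μ
      - gaugeDir W (spikeW (L ^ (j + 1)) (fun z => h z + framePotW L (j + 1) W Y z)) y μ) := by
  obtain ⟨hfs, hfP⟩ := framePotW_skew_periodic (M := N) hL j hWu hWP hx hs hWx hY hYP
  -- the heights `g = h + framePotW Y` are skew and `N`-periodic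
  have hgs : ∀ z, (fun z => h z + framePotW L (j + 1) W Y z) z ∈ skewAdjoint (Matrix n n ℂ) :=
    fun z => (skewAdjoint _).add_mem (hh z) (hfs z)
  have hgP : ∀ (z : Site d) (τ : Fin d),
      (fun z => h z + framePotW L (j + 1) W Y z) (z + (N : ℤ) • e τ) = (fun z => h z + framePotW L (j + 1) W Y z) z := by
    intro z τ; simp only [hhP z τ, hfP z τ]
  -- the spike direction has the same k-fold linearised average as `Y`
  have hS := dirIter_gaugeDir_spikeW hL j hWu hWP hx hs hWx hgs hgP
  have hYd := dirIter_eq_QbarIter_add_gaugeDir (M := N) hL j hWu hWP hx hs hWx hY hYP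
  have hYd' : dirIter L (j + 1) W Y = gaugeDir (cavgIter L (j + 1) W) (fun z => h z + framePotW L (j + 1) W Y z) := by
    rw [hYd, hQ]
    funext z κ
    rw [gaugeDir_add_fun]
  exact tangentIter_sub_of_dirIter_eq hL j hWu hx hs hWx (hYd'.trans hS.symm)

/-! ## §3 Criticality along the double-bar kernel -/

/-- **A TANGENT-CRITICAL BACKGROUND IS CRITICAL ALONG EVERY DIRECTION WHOSE DOUBLE-BAR AVERAGE IS A COARSE PURE GAUGE.**  Same class; `F` any
window; `W` tangent-critical on `F` (`dAction W φ F = 0` for every skew `(L^{j+1}N)`-periodic TANGENT `φ`).  Then `dAction W Y F = 0` for every skew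
`(L^{j+1}N)`-periodic `Y` with `QbarIter L (j+1) W Y = gaugeDir (cavgIter L (j+1) W) h`, `h` skew `N`-periodic. [folklore] -/
theorem dAction_eq_zero_of_QbarIter_eq_gaugeDir [Nonempty n] {L N : ℕ} [NeZero N] (hL : 1 ≤ L) (j : ℕ)
    {W : Site d → Fin d → (Matrix n n ℂ)ˣ} {x : ℝ}
    (hWu : IsUnitaryCfg W) (hWP : IsPeriodicCfg W ((tower L N (j + 1) : ℕ) : ℤ)) (hx : 0 ≤ x) (hs : LevelSmall d L j x) (hWx : SmallField W x)
    (F : Finset (Plaq d))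
    (hcrit : ∀ φ : Site d → Fin d → Matrix n n ℂ, IsSkewDir φ → IsPeriodicDir φ ((tower L N (j + 1) : ℕ) : ℤ) →
      TangentIter L j W φ → dAction W φ F = 0)
    {Y : Site d → Fin d → Matrix n n ℂ} (hY : IsSkewDir Y) (hYP : IsPeriodicDir Y ((tower L N (j + 1) : ℕ) : ℤ))
    {h : Site d → Matrix n n ℂ} (hh : ∀ z, h z ∈ skewAdjoint (Matrix n n ℂ)) (hhP : ∀ (z : Site d) (τ : Fin d), h (z + (N : ℤ) • e τ) = h z)
    (hQ : QbarIter L (j + 1) W Y = gaugeDir (cavgIter L (j + 1) W) h) :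
    dAction W Y F = 0 := by
  have hM : 1 ≤ L ^ (j + 1) := Nat.one_le_pow _ L (by omega)
  obtain ⟨hfs, hfP⟩ := framePotW_skew_periodic (M := N) hL j hWu hWP hx hs hWx hY hYP
  let g : Site d → Matrix n n ℂ := fun z => h z + framePotW L (j + 1) W Y z
  have hgs : ∀ z, g z ∈ skewAdjoint (Matrix n n ℂ) := fun z => (skewAdjoint _).add_mem (hh z) (hfs z)
  have hgP : ∀ (z : Site d) (τ : Fin d), g (z + (N : ℤ) • e τ) = g z := by
    intro z τ; show h _ + framePotW L (j + 1) W Y _ = h z + framePotW L (j + 1) W Y z; rw [hhP z τ, hfP z τ]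
  -- the spike generator is skew and `(L^{j+1}N)`-periodic
  have hσs : ∀ y, spikeW (L ^ (j + 1)) g y ∈ skewAdjoint (Matrix n n ℂ) := spikeW_mem_skewAdjoint _ hgs
  have hσP : ∀ (y : Site d) (i : Fin d), spikeW (L ^ (j + 1)) g (y + ((tower L N (j + 1) : ℕ) : ℤ) • e i) = spikeW (L ^ (j + 1)) g y := by
    intro y i; rw [natCast_tower_eq_pow_mul]; exact spikeW_add_period hM hgP y i
  -- `Y − S` (`S` the spike direction) is skew, periodic and tangent, hence critical-null
  have hTs : IsSkewDir (fun y μ => Y y μ - gaugeDir W (spikeW (L ^ (j + 1)) g) y μ) :=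
    fun y μ => (skewAdjoint _).sub_mem (hY y μ) (gaugeDir_skew hWu hσs y μ)
  have hTP : IsPeriodicDir (fun y μ => Y y μ - gaugeDir W (spikeW (L ^ (j + 1)) g) y μ) ((tower L N (j + 1) : ℕ) : ℤ) := by
    intro y i μ
    have h1 := hYP y i μ
    have h2 := isPeriodicDir_gaugeDir hWP hσP y i μ
    simp only
    rw [h1, h2]
  have hTt : TangentIter L j W (fun y μ => Y y μ - gaugeDir W (spikeW (L ^ (j + 1)) g) y μ) :=
    tangentIter_sub_spike hL j hWu hWP hx hs hWx hY hYP hh hhP hQ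
  have h0 := hcrit _ hTs hTP hTt
  -- gauge invariance: adding the pure gauge `S` does not change the first variation
  have hadd := dAction_add_gaugeDir W (fun y μ => Y y μ - gaugeDir W (spikeW (L ^ (j + 1)) g) y μ) (spikeW (L ^ (j + 1)) g) F
  rw [sub_add_dir' Y (gaugeDir W (spikeW (L ^ (j + 1)) g))] at hadd
  rw [hadd, h0]

/-- **A TANGENT-CRITICAL BACKGROUND IS CRITICAL ALONG THE WHOLE DOUBLE-BAR KERNEL** (Bałaban's constraint space `Q̄_{k+1} Y = 0`): same class and
criticality hypothesis; every skew `(L^{j+1}N)`-periodic `Y` with `QbarIter L (j+1) W Y = 0` has `dAction W Y F = 0`. [folklore] -/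
theorem dAction_eq_zero_of_QbarIter_eq_zero [Nonempty n] {L N : ℕ} [NeZero N] (hL : 1 ≤ L) (j : ℕ)
    {W : Site d → Fin d → (Matrix n n ℂ)ˣ} {x : ℝ}
    (hWu : IsUnitaryCfg W) (hWP : IsPeriodicCfg W ((tower L N (j + 1) : ℕ) : ℤ)) (hx : 0 ≤ x) (hs : LevelSmall d L j x) (hWx : SmallField W x)
    (F : Finset (Plaq d))
    (hcrit : ∀ φ : Site d → Fin d → Matrix n n ℂ, IsSkewDir φ → IsPeriodicDir φ ((tower L N (j + 1) : ℕ) : ℤ) →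
      TangentIter L j W φ → dAction W φ F = 0)
    {Y : Site d → Fin d → Matrix n n ℂ} (hY : IsSkewDir Y) (hYP : IsPeriodicDir Y ((tower L N (j + 1) : ℕ) : ℤ))
    (hQ : QbarIter L (j + 1) W Y = 0) :
    dAction W Y F = 0 := by
  have hQ' : QbarIter L (j + 1) W Y = gaugeDir (cavgIter L (j + 1) W) (fun _ => (0 : Matrix n n ℂ)) := by
    rw [hQ, gaugeDir_zero_fun']; rfl
  exact dAction_eq_zero_of_QbarIter_eq_gaugeDir hL j hWu hWP hx hs hWx F hcrit hY hYP
    (fun _ => (skewAdjoint _).zero_mem) (fun _ _ => rfl) hQ'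

/-- **THE TANGENT-PLUS-SPIKE FORM**: same class and criticality hypothesis; for every skew `(L^{j+1}N)`-periodic TANGENT `T` and every skew `N`-periodic
height field `g`, `dAction W (T + gaugeDir W (spikeW L^{j+1} g)) F = 0` — the directions the Bałaban-gauge supplier produces (memo §2). [folklore] -/
theorem dAction_tangent_add_spike_eq_zero {L N : ℕ} (j : ℕ) {W : Site d → Fin d → (Matrix n n ℂ)ˣ} (F : Finset (Plaq d))
    (hcrit : ∀ φ : Site d → Fin d → Matrix n n ℂ, IsSkewDir φ → IsPeriodicDir φ ((tower L N (j + 1) : ℕ) : ℤ) →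
      TangentIter L j W φ → dAction W φ F = 0)
    {T : Site d → Fin d → Matrix n n ℂ} (hT : IsSkewDir T) (hTP : IsPeriodicDir T ((tower L N (j + 1) : ℕ) : ℤ)) (hTt : TangentIter L j W T)
    (g : Site d → Matrix n n ℂ) :
    dAction W (T + gaugeDir W (spikeW (L ^ (j + 1)) g)) F = 0 := by
  rw [dAction_add_gaugeDir, hcrit T hT hTP hTt]

end

end Summit.QuantumFields.BalabanUV.T4Continuum.NE7QbarTangentCritical
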